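import Literature.MathematicalPhysics.QuantumLattice.FermiRG.FST2Hypotheses
import Mathlib.MeasureTheory.Measure.Hausdorff
import Mathlib.Analysis.Convex.Strict
import Mathlib.Analysis.SpecialFunctions.Log.Basic
import HarnessLib

/-!
# Feldman–Salmhofer–Trubowitz II: the optimal volume bound and the second-order regularity theorem

Topic `Literature/MathematicalPhysics/QuantumLattice/FermiRG`; continues `FST2Hypotheses.lean` (the hypotheses
(A1)–(A5), (A4′), (Sy), the crystal datum `Crystal`, `GeomConstants`). Source:

* [II] J. Feldman, M. Salmhofer, E. Trubowitz, *Perturbation theory around non-nested Fermi surfaces II.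
  Regularity of the moving Fermi surface: RPA contributions*, Comm. Pure Appl. Math. **51** (1998)
  1133–1246, arXiv:cond-mat/9701073 (`FeldmanSalmhoferTrubowitz1998`); locators `p.N Lm` = chunk/line of
  the `lit read arxiv:cond-mat/9701073` render of the arXiv TeX, `(foo)` = TeX label `\EQN\foo`. The three
  theorems of the Introduction lose their numbers in the render; by order they are Theorem 1.1 (TeX
  `\bestvol`, the volume bound, p.2 L118–p.3 L1), Theorem 1.2 (`\zweireg`, second order, p.3 L51–62) and
  Theorem 1.3 (`\RPAreg`, the RPA graphs, p.4 L17–36).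

## What is typed (gate-hubbard-kl wave, DAG file F4b)

* `HypA3Global cr e` — the GLOBAL half of (A3) as printed (p.7 L59–60: "(A3) implies that `S` bounds a
  strictly convex set; in two dimensions, `S` is a simple closed curve"), which [II] uses from Lemma 2.1′
  (`\Lem\byAfive`, p.7 L141–p.8 L35: no three collinear points, the longest chord) on: `S ∩ F` is the
  boundary of ONE compact strictly convex body. `FST2Hypotheses.HypA3` is the local (curvature) half; a
  periodic `e` with several Fermi pockets satisfies the local half but not this one, and Lemma `\Lem\findCP`
  below is false for it — so every statement of this file that assumes (A3) assumes both halves;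
* `volW cr e ε` — the two-loop volume `𝓦(ε)` of [II (cWdef), p.2 L107–113] (and [I, (A.6)]), with the surface
  measure on `S` taken to be the `(d-1)`-dimensional Hausdorff measure on the representatives `S ∩ F`
  (see "Faithfulness" below);
* `VolumeBound` — **Theorem 1.1** as a NAMED FACT (`def … : Prop`, D-0014), both clauses (`d = 2`:
  `Q_V ε |log ε|`; `d ≥ 3`: `Q_V ε`), with the printed constant dependence "`Q_V` depends only on `|e|₂`,
  `r₀`, `g₀`, `w₀`" typed as uniformity over all `e` admitting the same `GeomConstants`;
* `LemmaWBound` — **Lemma 2.1** (`\Lem\wBound`, p.9 L1–12, with p.7 L136–140): (A2)_{k,h}, (A3), `k ≥ 2`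
  give valid geometric constants — a named fact, DISCHARGED in §5 (`LemmaWBound_holds`, by continuity
  and compactness of a fundamental parallelepiped of `Γ#`);
* `lComb`, `LemmaFindCP` — **Lemma 3.x** (`\Lem\findCP`, p.15 L140–p.16 L12): under (A2)_{2,0}, (A3), (A5)
  the critical points of `η_b` on the Fermi surface are the listed antipodal configurations — a NAMED FACT;
* `eq_of_two_smul_eq_add_of_hypA3Global` — **Lemma 2.1′ (i)** (`\Lem\byAfive`, p.7 L141–p.8 L12: no three
  collinear points of `S`), PROVED in §6 from `HypA3Global`;
* `SecondOrderData`, `SecondOrderRegularity` — **Theorem 1.2** TYPED AROUND A GAP: its conclusion is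
  about the renormalised second-order counterterm `K₂(e,V,·)` and self-energy `Σ₂` of the expansion of
  [I §2]/[II §2.6, p.11 L60–110; §3.1 (socalled) p.12 L60–75] (scale decomposition, projection `ℓ` onto
  the Fermi surface along the coordinates of [I, Lemma 2.1], limit `I → -∞`), objects the tree does NOT
  construct. Per the wave's gap protocol the statement is typed as a predicate in a binder
  `G : SecondOrderData E` standing for those objects (gap `G-t4-1` of HOME/GAP-LEDGER.md); it becomes a
  named fact the day `K₂, Σ₂` are constructed and substituted for `G`. Nothing is asserted.

## Faithfulness notes (for the referee)

* `𝓦(ε)`: [II] integrates `dθ₁ dθ₂` over `S^{d-1} × S^{d-1}` in the angular coordinate of §2.2 (for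
  `d = 2`: `θ ∈ ℝ/2πℤ` at constant speed `1/P`, p.9 L60–62; for `d ≥ 3`: an unspecified
  `C^k`-diffeomorphism `S → S^{d-1}` with uniformly bounded Jacobian, p.8 L126–131). We integrate the
  Hausdorff measure `μH[d-1]` on `S ∩ F` instead; the two differ by a Jacobian bounded above and below in
  terms of the geometric constants (`P⁻²` exactly, for `d = 2`), which the constant `Q_V` absorbs — so the
  typed dependence "`Q_V` depends only on (`K, r₀, g₀, wmin`) and the crystal" is the printed one.
* Theorem 1.1 is printed "for all `ε > 0`"; for `d = 2` the right side `Q_V ε |log ε|` vanishes at `ε = 1`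
  while `𝓦(1) > 0`, and the proof (App. B, p.33 L60–62) says "we may assume `ε ≤ κ/2` since the estimate
  is trivially true for `ε` bounded away from zero by choice of the constant". We therefore type the
  small-`ε` range `0 < ε ≤ 1/2` (weaker than the letter of the statement; equivalent to any range
  `0 < ε ≤ ε₀ < 1` by enlarging `Q_V`).
* Hypotheses exactly as printed: Theorem 1.1 assumes (A2)_{2,0}, (A3), (A4) ((A5) "is not needed", p.3 L2,
  App. B p.32 L5); Theorem 1.2 (i) (`d = 2`) assumes (A1)_{k,h'}, (A2)_{k,h'}, (A3)–(A5), (ii) (`d ≥ 3`)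
  assumes (A1)_{2,h'}, (A2)_{2,h'}, (A3), (A4) — no filling restriction for `d ≥ 3` (p.1 L107), and (A4′)
  enters only Theorem 1.3 (ii) (p.9 L146–149), not typed here. `r!` growth / non-summability statements
  of [II] are not touched (nothing here asserts convergence of any series); the Hölder exponent of `Σ₂` is
  `γ < 1` strictly ("`Σ₂ ∈ C^{2-ε}`", p.3 L66–70; `Σ₂ ∉ C²` expected in `d = 2`, (Siglog) p.3 L77).

## What is NOT here

* Theorem 1.3 (RPA regularity, Chapter 4), Lemma 2.2 (`\Lem\UVpart`, scale-zero effective action,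
  p.10 L90–98), Lemma 3.y (`\Lem\jaythree`, p.15 L36–50) and the strings theorem of §3.5 (p.18 L90ff): all
  are statements about the renormalised expansion objects (the same gap) and are left untyped in this wave.
* Any instantiation at a model (Hubbard or other); any claim about the Kohn–Luttinger programme.
-/

noncomputable section

open Set Filter MeasureTheory
open scoped NNReal ENNReal Topology

namespace Literature.MathematicalPhysics.QuantumLattice.FermiRG

open Literature.Analysis.FunctionSpaces (MemContDiffHolder)

variable {E : Type*} [NormedAddCommGroup E] [InnerProductSpace ℝ E] [CompleteSpace E]
  [MeasurableSpace E] [BorelSpace E]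

/-! ### §0 The global half of (A3) [II p.7 L59–60] -/

omit [CompleteSpace E] [MeasurableSpace E] [BorelSpace E] in
/-- FST2.A3 (global half) · [II] Assumption (A3), second sentence · p.7 L59–60: "(A3) implies that `S` bounds
a strictly convex set. In two dimensions, `S` is a simple closed curve." [II] states this as a consequence
of the positivity of the curvature and USES it throughout (uniqueness of the antipode p.7 L60–66; Lemma 2.1′
`\Lem\byAfive` p.7 L141–p.8 L35: "if `p, q, r ∈ S` and `2q = p + r` then `p = q = r`", proved from "`S` is
strictly convex, so collinearity can hold only if `p = q = r`"; App. B p.32 L20–27). For a periodic band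
function it does not follow from the local condition `FST2Hypotheses.HypA3` (several Fermi pockets), so it
is typed as a separate predicate: the representatives `S ∩ F` form the boundary of one compact, strictly
convex body with non-empty interior (Mathlib `StrictConvex`: open segments between points of the body lie
in its interior — exactly the "no three collinear points of `S`" property). Never asserted.
[cite: FeldmanSalmhoferTrubowitz1998, Assumption A3 (arXiv p.7 L59–60)] -/
def HypA3Global (cr : Crystal E) (e : E → ℝ) : Prop :=
  ∃ C : Set E, IsCompact C ∧ StrictConvex ℝ C ∧ (interior C).Nonempty ∧ cr.fermiSurfaceRep e = frontier C

/-! ### §1 The two-loop volume `𝓦(ε)` and Theorem 1.1 [II p.2 L100–p.3 L1, App. B] -/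

/-- The dimension `d - 1` of the Fermi surface, as the real parameter of the Hausdorff measure
(`d = dim E`; [II] p.2 L113–117: "`θ` runs over `S^{d-1}`"). [cite: FeldmanSalmhoferTrubowitz1998, §1 eq. (cWdef) (arXiv p.2 L113–117)] -/
def surfaceDim (E : Type*) [NormedAddCommGroup E] [InnerProductSpace ℝ E] : ℝ :=
  ((Module.finrank ℝ E - 1 : ℕ) : ℝ)

/-- FST2.T1.1 (object) · [II] eq. (cWdef) · p.2 L107–113 (= [I, (A.6)]). The two-loop phase-space volume
`𝓦(ε) = sup_{q ∈ 𝓑} max_{vᵢ = ±1} ∫_{S×S} dθ₁ dθ₂ 𝟙(|e(v₁ p(0,θ₁) + v₂ p(0,θ₂) + q)| ≤ ε)`, the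
sub-integral that every graph with overlapping loops contains. Typed with the `(d-1)`-dimensional
Hausdorff measure on the representatives `S ∩ F` of the Fermi surface in place of [II]'s angular measure
`dθ` (they differ by a Jacobian controlled by the geometric constants — exactly `P⁻²` for `d = 2`,
p.9 L60 — which the constant of Theorem 1.1 absorbs); `q` ranges over `E` (`e` is `Γ#`-periodic, so this is
the supremum over `𝓑`). Values in `[0, ∞]`. [cite: FeldmanSalmhoferTrubowitz1998, §1 eq. (cWdef) (arXiv p.2 L107–113)] -/
def volW (cr : Crystal E) (e : E → ℝ) (ε : ℝ) : ℝ≥0∞ :=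
  ⨆ (q : E) (v₁ : ℝ) (_ : v₁ = 1 ∨ v₁ = -1) (v₂ : ℝ) (_ : v₂ = 1 ∨ v₂ = -1),
    ((μH[surfaceDim E]).restrict (cr.fermiSurfaceRep e)).prod
      ((μH[surfaceDim E]).restrict (cr.fermiSurfaceRep e))
      {x : E × E | |e (v₁ • x.1 + v₂ • x.2 + q)| ≤ ε}

/-- FST2.T1.1 · [II] **Theorem 1.1** (TeX `\bestvol`) · p.2 L118–p.3 L1; proof in Appendix B (p.32 L1–p.38).
"Assume (A2)_{2,0}, (A3) and (A4). Then there is a constant `Q_V ≥ 1` such that for all `ε > 0`,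
`𝓦(ε) ≤ Q_V ε |log ε|` if `d = 2` and `𝓦(ε) ≤ Q_V ε` if `d ≥ 3`. The constant `Q_V` depends only on
`|e|₂ = sup_p Σ_{|α| ≤ 2} |D^α e(p)|` and the numbers `r₀, g₀, w₀` (defined in Chapter 2)." ((A5) is not
needed, p.3 L2; "this estimate is best possible", App. B p.32 L6; it improves [I]'s `𝓦(ε) ≤ const ε^{(d-1)/d}`
under strict convexity, (FSTvol) p.2 L116.) Typed: for a fixed crystal and fixed constants
`(K, r₀, g₀, wmin)` ONE `Q ≥ 1` serves every `e` with (A2)_{2,0}, (A3), (A4) and `GeomConstants e K r₀ g₀ wmin`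
(the printed dependence; (A3) with both halves, `HypA3` and `HypA3Global`), on the small-`ε` range `0 < ε ≤ 1/2` that the proof addresses (App. B p.33
L60–62; the printed "all `ε > 0`" is false at `ε = 1` for `d = 2` as `|log 1| = 0` — flagged, typed weaker).
A named fact (D-0014), not proved here. [cite: FeldmanSalmhoferTrubowitz1998, Theorem 1.1 (arXiv p.2 L118–p.3 L1; App. B)] -/
def VolumeBound : Prop :=
  ∀ (E : Type) [NormedAddCommGroup E] [InnerProductSpace ℝ E] [CompleteSpace E] [MeasurableSpace E]
    [BorelSpace E] (cr : Crystal E) (K r₀ g₀ wmin : ℝ),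
    ∃ Q : ℝ, 1 ≤ Q ∧ ∀ e : E → ℝ,
      HypA2 cr 2 0 e → HypA3 e → HypA3Global cr e → HypA4 cr e → GeomConstants e K r₀ g₀ wmin →
      ∀ ε : ℝ, 0 < ε → ε ≤ 1 / 2 →
        (Module.finrank ℝ E = 2 → volW cr e ε ≤ ENNReal.ofReal (Q * ε * |Real.log ε|)) ∧
        (3 ≤ Module.finrank ℝ E → volW cr e ε ≤ ENNReal.ofReal (Q * ε))

/-! ### §2 Lemma 2.1: the geometric constants exist [II p.7 L136–140, p.9 L1–35] -/

/-- FST2.L.wBound · [II] **Lemma 2.1** (TeX `\Lem\wBound`) · p.9 L1–12, together with the "elementary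
consequences" p.7 L136–140 ("(A2) and (A3) [with compactness] imply that there are `ε₁ > 0` and `g₀ > 0`
such that `|∇e(p)| ≥ g₀` for all `p ∈ U_{ε₁}(S)`") and (gzerinit) p.8 L38–41. Lemma 2.1: "By (A2), for all
`|ρ| < r₀` and all `θ`, `κ(ρ,θ) |∇e(p(ρ,θ))| = ∓ w(p(ρ,θ))/|∂_θ p(ρ,θ)|²`. By (A3) there is `κ₀ > 0` with
`κ(0,θ) ≥ 2κ₀`; thus `r₀ > 0` can be chosen so small that for all `|ρ| < r₀` and all `θ`, `κ(ρ,θ) ≥ κ₀`,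
and there is `wmin > 0` such that `|w(p(ρ,θ))| ≥ wmin |∂_θ p(ρ,θ)|²`; moreover
`|∂²_θ p(ρ,θ)| ≥ (wmin/|e|₁) |∂_θ p(ρ,θ)|²`" (`wmin = κ₀ g₀`, p.9 L27). Typed, coordinate-free, as the
existence of valid `GeomConstants` (a bound `K` on the derivatives of order `≤ 2`, a width `r₀` with
`|∇e| ≥ g₀` and `(t, e''t) ≥ wmin |t|²` for tangent `t` on `{|e| < r₀}`) for every `Γ#`-periodic
`e ∈ C^{k,h}`, `k ≥ 2`, satisfying (A2)_{k,h} and (A3) (both halves), in finite dimension (so that `𝓑` is compact). The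
curvature-radius clause `|∂²_θ p| ≥ …` (a statement in the specific coordinates of [I, Lemma 2.1]) is not
typed. A named fact (D-0014); elementary (continuity and compactness of `S ⊂ 𝓑`).
[cite: FeldmanSalmhoferTrubowitz1998, Lemma 2.1 (arXiv p.9 L1–12) with p.7 L136–140] -/
def LemmaWBound : Prop :=
  ∀ (E : Type) [NormedAddCommGroup E] [InnerProductSpace ℝ E] [CompleteSpace E]
    [FiniteDimensional ℝ E] (cr : Crystal E) (k : ℕ) (h : ℝ≥0) (e : E → ℝ), 2 ≤ k →
    HypA2 cr k h e → HypA3 e → HypA3Global cr e → ∃ K r₀ g₀ wmin : ℝ, GeomConstants e K r₀ g₀ wmin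

/-! ### §3 Lemma 3.x (`\Lem\findCP`): the critical points on the Fermi surface [II §3.4, p.15 L140–p.16 L55] -/

omit [CompleteSpace E] [MeasurableSpace E] [BorelSpace E] in
/-- FST2.L.findCP (object) · [II] eq. (Ladef) · p.13 L88–93. The three linear combinations through which the
external momentum enters the highest-scale line of the second-order graph:
`L₁(p₁,p₂,p) = p + p₁ - p₂`, `L₂(p₁,p₂,p) = p - p₁ + p₂`, `L₃(p₁,p₂,p) = -p + p₁ + p₂` (junk `L_b = L₃`
for `b ∉ {1,2,3}`). [cite: FeldmanSalmhoferTrubowitz1998, §3.2 eq. (Ladef) (arXiv p.13 L88–93)] -/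
def lComb (b : ℕ) (p₁ p₂ p : E) : E :=
  if b = 1 then p + p₁ - p₂ else if b = 2 then p - p₁ + p₂ else -p + p₁ + p₂

/-- FST2.L.findCP · [II] **Lemma 3.x** (TeX `\Lem\findCP`, §3.4) · p.15 L140–p.16 L12 (proof p.16 L13–55,
using Lemma 2.1′ `\Lem\byAfive` = the (A3)+(A5) chord lemma p.7 L141–p.8 L35). "Let `d ≥ 2`. Assume
(A2)_{2,0}, (A3) and (A5). Then all solutions `(θ₁, θ₂)` of the critical point equation (etbcrit)
`∇e(L_b(p(0,θ₁), p(0,θ₂), p(0,θ))) · ∂_θ p(0,θᵢ) = 0` (`i = 1,2`) for which `L_b(p₁,p₂,p(0,θ)) ∈ S`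
holds are given by `(θ₁*, θ₂*) = c_{b,l}(θ)` with `c_{b,1}(θ) = (θ,θ)`; `c_{b,2}(θ) = (a(θ),θ)` for
`b = 1,3`, `(θ,a(θ))` for `b = 2`; `c_{b,3}(θ) = (a(θ),a(θ))` for `b = 1,2`, `(θ,a(θ))` for `b = 3`; `a`
the antipodal map (antidef)." Typed coordinate-free: points `p, p₁, p₂` of `S ∩ F`, the critical-point
condition as "`∇e` at `Q = L_b(p₁,p₂,p)` is orthogonal to the tangent spaces of `S` at `p₁` and at `p₂`"
(for `d ≥ 3`, `θᵢ ∈ S^{d-1}` and (etbcrit) is the vanishing of all tangential derivatives), `Q ∈ S`, and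
the conclusion as the list of admissible pairs `(p₁,p₂) ∈ {(p,p), (a p,p) [b ≠ 2], (p,a p) [b ≠ 1],
(a p,a p) [b ≠ 3]}` for an antipodal self-map `a` of `S ∩ F` ((A3) with both halves: with several Fermi
pockets the statement is false). A named fact (D-0014); elementary convex
geometry. [cite: FeldmanSalmhoferTrubowitz1998, Lemma findCP §3.4 (arXiv p.15 L140–p.16 L12)] -/
def LemmaFindCP : Prop :=
  ∀ (E : Type) [NormedAddCommGroup E] [InnerProductSpace ℝ E] [CompleteSpace E] (cr : Crystal E)
    (e : E → ℝ) (a : E → E), 2 ≤ Module.finrank ℝ E →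
    HypA2 cr 2 0 e → HypA3 e → HypA3Global cr e → HypA5 cr e →
    IsAntipodalMapOn e (cr.fermiSurfaceRep e) a →
    ∀ (b : ℕ), (b = 1 ∨ b = 2 ∨ b = 3) →
    ∀ p ∈ cr.fermiSurfaceRep e, ∀ p₁ ∈ cr.fermiSurfaceRep e, ∀ p₂ ∈ cr.fermiSurfaceRep e,
      lComb b p₁ p₂ p ∈ fermiSurface e →
      (∀ t : E, inner ℝ (gradient e p₁) t = 0 → inner ℝ (gradient e (lComb b p₁ p₂ p)) t = 0) →
      (∀ t : E, inner ℝ (gradient e p₂) t = 0 → inner ℝ (gradient e (lComb b p₁ p₂ p)) t = 0) →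
        (p₁ = p ∧ p₂ = p) ∨ (b ≠ 2 ∧ p₁ = a p ∧ p₂ = p) ∨ (b ≠ 1 ∧ p₁ = p ∧ p₂ = a p) ∨
          (b ≠ 3 ∧ p₁ = a p ∧ p₂ = a p)

/-! ### §4 Theorem 1.2, typed around the gap "the renormalised second-order objects" [II p.3 L51–62] -/

/-- GAP BINDER `G-t4-1` (gate-hubbard-kl HOME/GAP-LEDGER.md) · [II] §2.6 p.11 L60–110 and §3.1 eq. (socalled)
p.12 L60–75, with [I, §2 and Theorem 1.2]. Stands for the renormalised SECOND-ORDER self-energy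
`Σ₂(e,V)(p₀,p)` and counterterm `K₂(e,V)(p) = (ℓ Σ₂^{unsub})(p) = Σ₂^{unsub}(0, π(p))` of the expansion
of [I]/[II] — "in first order, `K₁ = ℓ Σ₁^{unsub}`, `Σ₁ = Σ₁^{unsub} - K₁`; `Σ₂^{unsub}` is the sum of the
values of all 1PI two-legged second-order graphs with two-legged insertions subtracted on the Fermi
surface; `K₂ = ℓ Σ₂^{unsub}`, `Σ₂ = Σ₂^{unsub} - K₂`; `K_r = lim_{I → -∞} K_r^I`" (p.11 L75–100) — as maps
from the data `(e, v̂)`. These objects (propagator `e^{ip₀0⁺}/(ip₀ - e)`, scale decomposition (CpzE),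
projection `ℓ` along the coordinates of [I, Lemma 2.1], infrared limit) are NOT constructed in the
tree; this structure carries NO constraint and only lets Theorem 1.2 be typed around the gap. `K₂` is
real-valued by (A1) (p.7 L36). [cite: FeldmanSalmhoferTrubowitz1998, §2.6 (arXiv p.11 L60–110)] -/
structure SecondOrderData (E : Type*) [NormedAddCommGroup E] [InnerProductSpace ℝ E] where
  /-- `(e, v̂) ↦ Σ₂(e, V) : ℝ × 𝓑 → ℂ` -/
  selfEnergy : (E → ℝ) → (ℝ × E → ℂ) → ℝ × E → ℂ
  /-- `(e, v̂) ↦ K₂(e, V) : 𝓑 → ℝ` -/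
  counterterm : (E → ℝ) → (ℝ × E → ℂ) → E → ℝ

omit [MeasurableSpace E] [BorelSpace E] in
/-- FST2.T1.2 · [II] **Theorem 1.2** (TeX `\zweireg`) · p.3 L51–62; proved in Chapter 3 (`d = 2` via Lemma
`\jaythree`, p.15 L36–52; `d ≥ 3` in §3.6, p.25 L80). "(i) Let `d = 2`. There exists `h > 0` such that if
`0 ≤ h' ≤ h`, `k ≥ 2`, and (A1)_{k,h'}, (A2)_{k,h'}, (A3)–(A5) hold, then `K₂(e,V,p)` is `C^{k,h'}` in `p`.
Moreover, the second order self-energy `Σ₂` is `C^{1,γ}` in `p` for any `γ ∈ (0,1)`. (ii) Let `d ≥ 3`.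
There exists `h > 0` such that if `0 ≤ h' ≤ h`, and (A1)_{2,h'}, (A2)_{2,h'}, (A3) and (A4) hold, then
`K₂` and `Σ₂` are `C^{2,h'}` in `p`. Here `C^{k,h}` is the set of functions all of whose `k`th order
derivatives are Hölder continuous of index `h`; `h' = 0` is allowed." (Remarks p.3 L64–76: for `d = 2`,
`Σ₂` is only `C^{1,γ}`, `γ < 1`, even for `e, v̂ ∈ C^k`; the transversal/`p₀` second derivative is at
most logarithmically divergent, (Siglog).) TYPED AROUND GAP `G-t4-1`: a predicate in the binder
`G : SecondOrderData E` standing for `(Σ₂, K₂)`; regularity "in `p`" of `Σ₂` read at each fixed `p₀`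
through `MemContDiffHolder` of the spatial section. It is the printed implication once `G` is the
constructed pair; nothing is asserted. [cite: FeldmanSalmhoferTrubowitz1998, Theorem 1.2 (arXiv p.3 L51–62)] -/
def SecondOrderRegularity (cr : Crystal E) (G : SecondOrderData E) : Prop :=
  (Module.finrank ℝ E = 2 →
    ∃ h : ℝ≥0, 0 < h ∧ ∀ (h' : ℝ≥0) (k : ℕ) (e : E → ℝ) (v : ℝ × E → ℂ), h' ≤ h → 2 ≤ k →
      HypA1 cr k h' v → HypA2 cr k h' e → HypA3 e → HypA3Global cr e → HypA4 cr e → HypA5 cr e →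
        MemContDiffHolder k h' (G.counterterm e v) ∧
        ∀ γ : ℝ≥0, 0 < γ → γ < 1 →
          ∀ p₀ : ℝ, MemContDiffHolder 1 γ (fun p : E => G.selfEnergy e v (p₀, p))) ∧
  (3 ≤ Module.finrank ℝ E →
    ∃ h : ℝ≥0, 0 < h ∧ ∀ (h' : ℝ≥0) (e : E → ℝ) (v : ℝ × E → ℂ), h' ≤ h →
      HypA1 cr 2 h' v → HypA2 cr 2 h' e → HypA3 e → HypA3Global cr e → HypA4 cr e →
        MemContDiffHolder 2 h' (G.counterterm e v) ∧
        ∀ p₀ : ℝ, MemContDiffHolder 2 h' (fun p : E => G.selfEnergy e v (p₀, p)))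

/-! ### §5 Proof of Lemma 2.1 (`LemmaWBound`): continuity and compactness of `S ⊂ 𝓑` -/

section LemmaWBoundProof

open Metric
open Literature.Analysis.FunctionSpaces (eSupNorm enorm_le_eSupNorm)

/-- Pointwise bound by the (finite) sup norm. [folklore] -/
private theorem norm_le_toReal_eSupNorm {X Y : Type*} [NormedAddCommGroup Y] (f : X → Y)
    (hf : eSupNorm f < ∞) (x : X) : ‖f x‖ ≤ (eSupNorm f).toReal := by
  have h := ENNReal.toReal_mono hf.ne (enorm_le_eSupNorm f x)
  rwa [enorm_eq_nnnorm, ENNReal.coe_toReal, coe_nnnorm] at h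

/-- If `g > 0` on the zero set of `f` inside a compact set `s` (both continuous), then `g ≥ c > 0` on
`s ∩ {|f| < r}` for some `r > 0`. [folklore] -/
private theorem exists_uniform_pos_near_zero {X : Type*} [TopologicalSpace X] {s : Set X}
    (hs : IsCompact s) {f g : X → ℝ} (hf : Continuous f) (hg : Continuous g)
    (hpos : ∀ x ∈ s, f x = 0 → 0 < g x) :
    ∃ r c : ℝ, 0 < r ∧ 0 < c ∧ ∀ x ∈ s, |f x| < r → c ≤ g x := by
  obtain ⟨c', hc', hge⟩ := (hs.inter_right (isClosed_eq hf continuous_const)).exists_forall_le'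
    hg.continuousOn (a := 0) (fun x hx => hpos x hx.1 hx.2)
  have hB : IsCompact (s ∩ {x | g x ≤ c' / 2}) := hs.inter_right (isClosed_le hg continuous_const)
  obtain ⟨r, hr, hrle⟩ := hB.exists_forall_le' (f := fun x => |f x|)
    (continuous_abs.comp hf).continuousOn (a := 0)
    (fun x hx => abs_pos.2 fun h0 => by
      have h1 := hge x ⟨hx.1, h0⟩
      have h2 : g x ≤ c' / 2 := hx.2
      linarith)
  refine ⟨r, c' / 2, hr, by linarith, fun x hx hlt => ?_⟩
  by_contra hnot
  have := hrle x ⟨hx, (not_le.1 hnot).le⟩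
  linarith

variable {E : Type*} [NormedAddCommGroup E] [InnerProductSpace ℝ E] [CompleteSpace E]
  [FiniteDimensional ℝ E]

omit [CompleteSpace E] in
/-- A compact set of representatives of `𝓑 = E/Γ#` (closure of the parallelepiped of a `ℤ`-basis). [folklore] -/
private theorem Crystal.exists_isCompact_rep (cr : Crystal E) :
    ∃ Kc : Set E, IsCompact Kc ∧ ∀ p : E, ∃ γ ∈ cr.dualLattice, p + γ ∈ Kc := by
  haveI := cr.discrete
  haveI : IsZLattice ℝ cr.dualLattice := ⟨cr.span_eq_top⟩
  let bz := Module.Free.chooseBasis ℤ cr.dualLattice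
  let b := bz.ofZLatticeBasis ℝ cr.dualLattice
  refine ⟨closure (ZSpan.fundamentalDomain b), (ZSpan.fundamentalDomain_isBounded b).isCompact_closure,
    fun p => ?_⟩
  obtain ⟨v, hv, -⟩ := ZSpan.exist_unique_vadd_mem_fundamentalDomain b p
  refine ⟨(v : E), ?_, ?_⟩
  · have hspan := bz.ofZLatticeBasis_span ℝ cr.dualLattice
    have hv2 : (v : E) ∈ Submodule.span ℤ (Set.range b) := v.2
    exact hspan.le hv2
  · have hvadd : (v +ᵥ p : E) = (v : E) + p := rfl
    rw [add_comm]; rw [hvadd] at hv; exact subset_closure hv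

omit [CompleteSpace E] [FiniteDimensional ℝ E] in
/-- `(a t, e''(p) a t) = a² (t, e''(p) t)`. [folklore] -/
private theorem hessQuad_smul (e : E → ℝ) (p t : E) (a : ℝ) :
    hessQuad e p (a • t) = a ^ 2 * hessQuad e p t := by
  unfold hessQuad
  have h : (![a • t, a • t] : Fin 2 → E) = fun i => a • (![t, t] : Fin 2 → E) i := by
    ext i; fin_cases i <;> simp
  rw [h, ContinuousMultilinearMap.map_smul_univ]
  simp [pow_two]

omit [CompleteSpace E] [FiniteDimensional ℝ E] in
/-- `(0, e''(p) 0) = 0`. [folklore] -/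
private theorem hessQuad_zero (e : E → ℝ) (p : E) : hessQuad e p 0 = 0 := by
  simpa using hessQuad_smul e p 0 0

/-- **Lemma 2.1 of [II] holds** (`LemmaWBound`): for a `Γ#`-periodic `e ∈ C^{k,h}`, `k ≥ 2`, with
`∇e ≠ 0` on `S` and `e'' > 0` on the tangent spaces along `S`, there are valid geometric constants
`(K, r₀, g₀, wmin)`. Proof: continuity of `e, ∇e, e''`, compactness of a fundamental parallelepiped of
`Γ#` and of the unit tangent bundle over it, and periodicity; the global half of (A3) is not used.
[cite: FeldmanSalmhoferTrubowitz1998, Lemma 2.1 (arXiv p.9 L1–12) with p.7 L136–140] -/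
theorem LemmaWBound_holds : LemmaWBound := by
  intro E _ _ _ _ cr k h e hk hA2 hA3 _
  have hcd : ContDiff ℝ k e := hA2.memContDiffHolder.1
  have hk' : (2 : WithTop ℕ∞) ≤ k := by exact_mod_cast hk
  have he_cont : Continuous e := hcd.continuous
  have hgrad_cont : Continuous (gradient e) := by
    have hk0 : (k : WithTop ℕ∞) ≠ 0 := by exact_mod_cast (show k ≠ 0 by omega)
    have h1 : Continuous (fderiv ℝ e) := hcd.continuous_fderiv hk0
    exact (InnerProductSpace.toDual ℝ E).symm.continuous.comp h1
  have hD2_cont : Continuous fun p => iteratedFDeriv ℝ 2 e p := hcd.continuous_iteratedFDeriv hk'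
  obtain ⟨Kc, hKc, hrep⟩ := cr.exists_isCompact_rep
  -- periodicity of `e`, `∇e`, `e''`
  have hper : ∀ γ ∈ cr.dualLattice, (fun x => e (x + γ)) = e :=
    fun γ hγ => funext fun x => hA2.periodic γ hγ x
  have hgrad_per : ∀ γ ∈ cr.dualLattice, ∀ p, gradient e (p + γ) = gradient e p := by
    intro γ hγ p
    unfold gradient
    rw [← fderiv_comp_add_right γ, hper γ hγ]
  have hD2_per : ∀ γ ∈ cr.dualLattice, ∀ p, iteratedFDeriv ℝ 2 e (p + γ) = iteratedFDeriv ℝ 2 e p := by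
    intro γ hγ p
    rw [← iteratedFDeriv_comp_add_right 2 γ p, hper γ hγ]
  -- (gzerinit): `|∇e| ≥ g₀` near `S`
  obtain ⟨r₁, g₀, hr₁, hg₀, hb⟩ := exists_uniform_pos_near_zero hKc he_cont
    (continuous_norm.comp hgrad_cont) (fun p _ hp0 => norm_pos_iff.2 (hA2.gradient_ne_zero p hp0))
  -- Lemma 2.1: `(t, e'' t) ≥ wmin` for unit tangent `t` near `S`
  set s : Set (E × E) := (Kc ×ˢ sphere (0 : E) 1) ∩ {x | inner ℝ (gradient e x.1) x.2 = 0} with hs_def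
  have hinner_cont : Continuous fun x : E × E => inner ℝ (gradient e x.1) x.2 :=
    (hgrad_cont.comp continuous_fst).inner continuous_snd
  have hs : IsCompact s :=
    (hKc.prod (isCompact_sphere (0 : E) 1)).inter_right (isClosed_eq hinner_cont continuous_const)
  have hq_cont : Continuous fun x : E × E => hessQuad e x.1 x.2 := by
    unfold hessQuad
    have h1 : Continuous fun x : E × E => iteratedFDeriv ℝ 2 e x.1 := hD2_cont.comp continuous_fst
    have h2 : Continuous fun x : E × E => (![x.2, x.2] : Fin 2 → E) :=
      continuous_pi fun i => by fin_cases i <;> simpa using continuous_snd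
    exact h1.eval h2
  obtain ⟨r₂, wmin, hr₂, hwmin, hc⟩ := exists_uniform_pos_near_zero hs (he_cont.comp continuous_fst)
    hq_cont (fun x hx hx0 => by
      have hx2 : ‖x.2‖ = 1 := mem_sphere_zero_iff_norm.1 hx.1.2
      have hne : x.2 ≠ 0 := by intro h0; rw [h0, norm_zero] at hx2; exact zero_ne_one hx2
      exact hA3 x.1 hx0 x.2 hne hx.2)
  -- `|e|₂ ≤ K`
  have hsup := hA2.memContDiffHolder.2.1
  set T : ℕ → ℝ := fun j => (eSupNorm (iteratedFDeriv ℝ j e)).toReal with hT_def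
  have hT : ∀ j ≤ 2, ∀ p : E, ‖iteratedFDeriv ℝ j e p‖ ≤ T j :=
    fun j hj p => norm_le_toReal_eSupNorm _ (hsup j (hj.trans hk)) p
  have hT0 : ∀ j, 0 ≤ T j := fun j => ENNReal.toReal_nonneg
  refine ⟨T 0 + T 1 + T 2, min r₁ r₂, g₀, wmin, ⟨lt_min hr₁ hr₂, hg₀, hwmin, ?_, ?_, ?_⟩⟩
  · intro p j hj
    have h1 := hT j hj p
    interval_cases j <;> linarith [hT0 0, hT0 1, hT0 2]
  · intro p hp
    obtain ⟨γ, hγ, hpγ⟩ := hrep p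
    have hlt : |e (p + γ)| < r₁ := by rw [hA2.periodic γ hγ p]; exact lt_of_lt_of_le hp (min_le_left _ _)
    have h1 := hb (p + γ) hpγ hlt
    simp only [Function.comp_apply] at h1
    rwa [hgrad_per γ hγ p] at h1
  · intro p hp t ht
    by_cases ht0 : t = 0
    · subst ht0; simp [hessQuad_zero]
    obtain ⟨γ, hγ, hpγ⟩ := hrep p
    have htn : 0 < ‖t‖ := norm_pos_iff.2 ht0
    set u : E := ‖t‖⁻¹ • t with hu_def
    have hu : ‖u‖ = 1 := by
      rw [hu_def, norm_smul, norm_inv, norm_norm]; exact inv_mul_cancel₀ htn.ne'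
    have hut : inner ℝ (gradient e (p + γ)) u = 0 := by
      rw [hgrad_per γ hγ p, hu_def, inner_smul_right, ht, mul_zero]
    have hmem : (p + γ, u) ∈ s := ⟨⟨hpγ, mem_sphere_zero_iff_norm.2 hu⟩, hut⟩
    have hlt : |e (p + γ)| < r₂ := by
      rw [hA2.periodic γ hγ p]; exact lt_of_lt_of_le hp (min_le_right _ _)
    have h1 := hc (p + γ, u) hmem hlt
    simp only at h1
    have h2 : hessQuad e (p + γ) u = ‖t‖⁻¹ ^ 2 * hessQuad e p t := by
      rw [hu_def, hessQuad_smul]; unfold hessQuad; rw [hD2_per γ hγ p]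
    rw [h2] at h1
    calc wmin * ‖t‖ ^ 2 ≤ ‖t‖⁻¹ ^ 2 * hessQuad e p t * ‖t‖ ^ 2 :=
          mul_le_mul_of_nonneg_right h1 (by positivity)
      _ = hessQuad e p t := by field_simp

end LemmaWBoundProof


/-! ### §6 Lemma 2.1′ (i) of [II] (`\Lem\byAfive`): no three collinear points of `S` — PROVED -/

section ByAfive

variable {E : Type*} [NormedAddCommGroup E] [InnerProductSpace ℝ E]

/-- FST2.L.byAfive (i) · [II] **Lemma 2.1′ (i)** (TeX `\Lem\byAfive`) · p.7 L141–p.8 L12: "Let `S` fulfil (A3)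
and (A5). (i) If `p, q, r ∈ S` and `2q = p + r`, then `p = q = r`" — "the three points are collinear, but
`p, q, r ∈ S`, so by strict convexity collinearity can hold only if `p = q = r`". PROVED from the global
half of (A3) (`HypA3Global`: `S ∩ F` is the boundary of a strictly convex body; the midpoint of two
distinct boundary points is interior, and `frontier ∩ interior = ∅`); (A5) is what lets [II] read the
equation in `ℝ^d` rather than on the torus — here the points are representatives in `E` from the start.
[cite: FeldmanSalmhoferTrubowitz1998, Lemma byAfive (i) §2.1 (arXiv p.7 L141–p.8 L12)] -/
theorem eq_of_two_smul_eq_add_of_hypA3Global {cr : Crystal E} {e : E → ℝ} (hG : HypA3Global cr e)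
    {p q r : E} (hp : p ∈ cr.fermiSurfaceRep e) (hq : q ∈ cr.fermiSurfaceRep e)
    (hr : r ∈ cr.fermiSurfaceRep e) (h2 : (2 : ℝ) • q = p + r) : p = q ∧ q = r := by
  obtain ⟨C, hCc, hCs, -, hS⟩ := hG
  rw [hS] at hp hq hr
  have hsub : frontier C ⊆ C := frontier_subset_closure.trans hCc.isClosed.closure_subset
  by_cases hpr : p = r
  · subst hpr
    have hqp : q = p := by
      have h' : (2 : ℝ) • q = (2 : ℝ) • p := by rw [h2, two_smul]
      exact smul_right_injective E (two_ne_zero' ℝ) h'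
    exact ⟨hqp.symm, hqp⟩
  · exfalso
    have hint : (1 / 2 : ℝ) • p + (1 / 2 : ℝ) • r ∈ interior C :=
      hCs (hsub hp) (hsub hr) hpr (by norm_num) (by norm_num) (by norm_num)
    have hq' : (1 / 2 : ℝ) • p + (1 / 2 : ℝ) • r = q := by
      rw [← smul_add, ← h2, smul_smul]; norm_num
    rw [hq'] at hint
    rw [frontier, Set.mem_sdiff] at hq
    exact hq.2 hint

end ByAfive

end Literature.MathematicalPhysics.QuantumLattice.FermiRG

end
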